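import Literature.Computability.AlgebraicComplexity.ConstantFreeCircuits
import Literature.Computability.AlgebraicComplexity.CircuitDepthProofs
import Literature.Computability.AlgebraicComplexity.CircuitGateSemantics
import Literature.Computability.AlgebraicComplexity.BrentFormulaDepthCircuits
import HarnessLib

/-!
# Composition of arithmetic circuits: wires and (product-)depth under substitution

Generic bookkeeping for the tree's list-presented circuits (`ArithCircuit.lean`,
`CircuitDepth.lean`): substituting circuits `Q_i` for ALL inputs `x_i` of a circuit `P`
(Bürgisser 2000, proof of Prop. 2.3 / Rem. 2.7: "juxtapose the programs for the `g_i` and feed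
their results into the program for `f`").  The tree already has the construction and its
SEMANTICS — `ArithCircuit.substCircuit` (a prefix gate list followed by the gates of `P` with every
input replaced by an operand reading the prefix), the juxtaposition `ArithCircuit.juxtGates` /
`ArithCircuit.juxtOuts` of a list of circuits, `ArithCircuit.eval_substCircuit`,
`ArithCircuit.eval_juxtOuts` (`ConstantFreeCircuits.lean`, where it serves `τ(f(g)) ≤ τ(f) + Σ τ(g_i)`)
— but only the GATE count of the result (`size_substCircuit`, `length_juxtGates`).  This file adds
the two measures of the constant-depth literature (LST 2021 §2, as recorded in `CircuitDepth.lean`):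

* WIRES (`ArithCircuit.edgeSize`, the sum of the fan-ins): `edgeSize_substCircuit`,
  `sum_fanIn_juxtGates`, and for the packaged composition `ArithCircuit.compose P Q`
  (`P` with the circuit `Q i` substituted for `x_i`, `i` ranging over a `Fintype`):
  **`edgeSize_compose`** `= edgeSize P + Σ_i edgeSize (Q i)` (exact);
* DEPTHS (`ArithCircuit.wdepth w` for a gate weight `w` invariant under the index bookkeeping,
  in particular `productDepth` and `depth`): `gateWDepths_juxtGates` (the depth list of a
  juxtaposition is the concatenation), `depthIn_juxtOuts`, `gateWDepths_substCircuit_le` (the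
  transported gates of `P` are at most `D` deeper, `D` a bound on the depths of the substituted
  operands), `wdepth_substCircuit_le`, and **`productDepth_compose_le`**
  `≤ productDepth P + max_i productDepth (Q i)`, `depth_compose_le` likewise;
* semantics and fan-in of the package: `eval_compose = aeval (fun i => (Q i).eval) P.eval`,
  `Computes.compose`, `size_compose`, `IsFanInTwo.compose`.

Motivation (val-lit t24, row AndrewsForbes2022-B): the "composition calculus for
`productDepthEdgeClass`" (wire size and product depth under substitution) recorded as missing in
`AndrewsForbes2022Applications.lean` ("NOT typed here", Thm. 6.8); the affine special case is
`ArithCircuit.affineComp` of `AndrewsForbes2022BorderComposition.lean`.  Everything here is a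
definition with a body or a proved theorem; no named facts.

Honest framing: circuit-model bookkeeping; nothing here bears on VP ≠ VNP (NOT proved).

## References

* [Burgisser2000] P. Bürgisser, *Completeness and Reduction in Algebraic Complexity Theory*,
  Springer 2000, Def. 2.1 (straight-line programs), proof of Prop. 2.3 and Rem. 2.7 (composition).
* [LimayeSrinivasanTavenas2021] N. Limaye, S. Srinivasan, S. Tavenas, FOCS 2021, §2 (size =
  wires, product-depth).
-/

noncomputable section

open MvPolynomial

namespace Literature.Computability.AlgebraicComplexity

universe u v w

namespace ArithCircuit

variable {k : Type u} {σ : Type v} {τ : Type w}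

/-! ### `max`-fold bookkeeping -/

/-- If `f a ≤ g a + D` on `l`, then `max_l f ≤ max_l g + D` (right folds of `max` from `0`;
bookkeeping for the depth of composed straight-line programs). [cite: Burgisser2000, proof of Prop. 2.3] -/
theorem foldr_max_map_le_foldr_max_map_add {α : Type*} (l : List α) {f g : α → ℕ} {D : ℕ}
    (h : ∀ a ∈ l, f a ≤ g a + D) : (l.map f).foldr max 0 ≤ (l.map g).foldr max 0 + D := by
  induction l with
  | nil => exact Nat.zero_le _
  | cons a l ih =>
    simp only [List.map_cons, List.foldr_cons]
    refine max_le ?_ ?_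
    · exact (h a List.mem_cons_self).trans (Nat.add_le_add_right (le_max_left _ _) D)
    · exact (ih fun b hb => h b (List.mem_cons_of_mem a hb)).trans
        (Nat.add_le_add_right (le_max_right _ _) D)

/-! ### Wires and depth lists of juxtapositions -/

section Juxt

/-- The wires of a juxtaposition add up: `Σ fan-ins (juxtGates L) = Σ_{Q ∈ L} edgeSize Q`.
[cite: Burgisser2000, proof of Prop. 2.3] -/
theorem sum_fanIn_juxtGates (L : List (ArithCircuit k τ)) :
    ((juxtGates L).map Gate.fanIn).sum = (L.map edgeSize).sum := by
  have hshift : ∀ (n : ℕ) (g : Gate k τ), (g.shift n).fanIn = g.fanIn := fun n g => by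
    cases g <;> simp [Gate.shift, Gate.fanIn, Gate.args]
  induction L with
  | nil => rfl
  | cons Q L ih =>
    rw [juxtGates, List.map_append, List.sum_append, List.map_map,
      show Gate.fanIn ∘ Gate.shift Q.size = (Gate.fanIn : Gate k τ → ℕ) from funext (hshift _), ih,
      List.map_cons, List.sum_cons]
    rfl

/-- **The depth list of a juxtaposition is the concatenation of the depth lists**, for a gate
weight `w` invariant under shifting gate references (e.g. the product weight and the unit weight).
[cite: Burgisser2000, proof of Prop. 2.3] -/
theorem gateWDepths_juxtGates (w : Gate k τ → ℕ) (hw : ∀ n g, w (Gate.shift n g) = w g)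
    (L : List (ArithCircuit k τ)) :
    gateWDepths w (juxtGates L) = (L.map fun Q => gateWDepths w Q.gates).flatten := by
  induction L with
  | nil => rfl
  | cons Q L ih =>
    simp only [juxtGates, List.map_cons, List.flatten_cons]
    rw [show Q.gates ++ (juxtGates L).map (Gate.shift Q.size) =
        (Q.append ⟨juxtGates L, Q.output⟩).gates from rfl, gateWDepths_append_of_shift w hw, ih]

/-- **Stability of the juxtaposed outputs, depth version**: the `i`-th output operand, read against
the depth list of the juxtaposition followed by anything, has the `w`-depth of the `i`-th circuit
(depth twin of `eval_juxtOuts`). [cite: Burgisser2000, proof of Prop. 2.3] -/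
theorem depthIn_juxtOuts [Zero k] (w : Gate k τ → ℕ) (hw : ∀ n g, w (Gate.shift n g) = w g)
    (L : List (ArithCircuit k τ)) (i : ℕ) (hi : i < L.length) (ds : List ℕ) :
    ((juxtOuts L)[i]'(by simpa using hi)).depthIn (gateWDepths w (juxtGates L) ++ ds) =
      (L[i]'hi).wdepth w := by
  induction L generalizing i ds with
  | nil => simp at hi
  | cons Q L ih =>
    have hQ : Q.size = (gateWDepths w Q.gates).length := (gateWDepths_length w Q.gates).symm
    rw [gateWDepths_juxtGates w hw]
    simp only [List.map_cons, List.flatten_cons]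
    rw [List.append_assoc]
    cases i with
    | zero =>
      have h0 := Operand.depthIn_truncate_append (k := k) (gateWDepths w Q.gates)
        ((L.map fun Q => gateWDepths w Q.gates).flatten ++ ds) Q.output
      rw [← hQ] at h0
      simp only [juxtOuts, List.getElem_cons_zero]
      rw [h0]
      rfl
    | succ i =>
      have hi' : i < L.length := by simpa using hi
      have h1 := Operand.depthIn_shift_append (k := k) (gateWDepths w Q.gates)
        ((L.map fun Q => gateWDepths w Q.gates).flatten ++ ds)
        ((juxtOuts L)[i]'(by simpa using hi'))
      rw [← hQ] at h1
      simp only [juxtOuts, List.getElem_cons_succ, List.getElem_map]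
      rw [h1, ← gateWDepths_juxtGates w hw, ih i hi' ds]

end Juxt

/-! ### Wires and depths of the substitution circuit -/

section Subst

/-- The operands of a substituted gate are the substituted operands. [cite: Burgisser2000, Rem. 2.7] -/
theorem Gate.args_subst_eq (ρ : σ → Operand k τ) (n : ℕ) (g : Gate k σ) :
    (g.subst ρ n).args = g.args.map (Operand.subst ρ n) := by
  cases g <;> simp [Gate.subst, Gate.args, List.map_map, Function.comp_def]

/-- Substitution does not change whether a gate is a product gate. [cite: Burgisser2000, Rem. 2.7] -/
theorem Gate.isProd_subst_eq (ρ : σ → Operand k τ) (n : ℕ) (g : Gate k σ) :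
    (g.subst ρ n).isProd = g.isProd := by
  cases g <;> rfl

/-- **Wires of the substitution circuit**: those of the prefix plus those of `P` (substitution
keeps every fan-in). [cite: Burgisser2000, Rem. 2.7] -/
theorem edgeSize_substCircuit (P : ArithCircuit k σ) (pre : List (Gate k τ)) (ρ : σ → Operand k τ) :
    (P.substCircuit pre ρ).edgeSize = (pre.map Gate.fanIn).sum + P.edgeSize := by
  simp [substCircuit, ArithCircuit.edgeSize, List.map_map, Function.comp_def, Gate.fanIn_subst]

/-- Depth of a substituted operand, with slack `D`: if every substituted operand `ρ i` has depth
`≤ D` against the prefix depths, and the list `E` of depths of the transported gates is pointwise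
at most `D` above the original depth list `ds`, then `u.subst ρ |pre|` read against `Dpre ++ E`
is at most `D` above `u` read against `ds`. [cite: Burgisser2000, Rem. 2.7] -/
theorem Operand.depthIn_subst_le {ρ : σ → Operand k τ} {Dpre : List ℕ} {D : ℕ}
    (hρ : ∀ i ds, (ρ i).depthIn (Dpre ++ ds) ≤ D) (u : Operand k σ) {ds E : List ℕ}
    (hE : ∀ j, E.getD j 0 ≤ ds.getD j 0 + D) :
    (u.subst ρ Dpre.length).depthIn (Dpre ++ E) ≤ u.depthIn ds + D := by
  cases u with
  | var i => simpa [Operand.subst, Operand.depthIn] using hρ i E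
  | const c => exact Nat.zero_le _
  | gate j =>
    simp only [Operand.subst, Operand.depthIn, List.getD_eq_getElem?_getD]
    rw [List.getElem?_append_right (by omega), Nat.add_sub_cancel]
    simpa [List.getD_eq_getElem?_getD] using hE j

/-- **Depth list of the substitution circuit, with slack**: for a gate weight `w` on `τ`-gates
agreeing with `w₀` on transported gates, if every substituted operand has depth `≤ D` against the
prefix depths, then the depth list of `pre ++ (gates of P, transported)` is the prefix depth list
followed by a list `E` which is pointwise at most `D` above the `w₀`-depth list of `P`'s gates.
[cite: Burgisser2000, Rem. 2.7] -/
theorem gateWDepths_substCircuit_le (w : Gate k τ → ℕ) (w₀ : Gate k σ → ℕ) {ρ : σ → Operand k τ}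
    {pre : List (Gate k τ)} (hw : ∀ g, w (g.subst ρ pre.length) = w₀ g) {D : ℕ}
    (hρ : ∀ i ds, (ρ i).depthIn (gateWDepths w pre ++ ds) ≤ D) (gs : List (Gate k σ)) :
    ∃ E : List ℕ, gateWDepths w (pre ++ gs.map (Gate.subst ρ pre.length)) = gateWDepths w pre ++ E ∧
      E.length = gs.length ∧ ∀ j, E.getD j 0 ≤ (gateWDepths w₀ gs).getD j 0 + D := by
  have hn : pre.length = (gateWDepths w pre).length := (gateWDepths_length w pre).symm
  induction gs using List.reverseRecOn with
  | nil => exact ⟨[], by simp, rfl, fun j => by simp⟩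
  | append_singleton gs g ih =>
    obtain ⟨E, hE, hlen, hle⟩ := ih
    -- the new entry of the transported list and of the original list
    set eNew : ℕ := w (g.subst ρ pre.length) +
      (((g.subst ρ pre.length).args.map (Operand.depthIn (gateWDepths w pre ++ E))).foldr max 0)
      with heNew
    set eOld : ℕ := w₀ g + ((g.args.map (Operand.depthIn (gateWDepths w₀ gs))).foldr max 0)
      with heOld
    have hnew : gateWDepths w (pre ++ (gs ++ [g]).map (Gate.subst ρ pre.length)) =
        gateWDepths w pre ++ (E ++ [eNew]) := by
      rw [List.map_append, List.map_singleton, ← List.append_assoc, gateWDepths_append_singleton,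
        hE, List.append_assoc]
    have hold : gateWDepths w₀ (gs ++ [g]) = gateWDepths w₀ gs ++ [eOld] :=
      gateWDepths_append_singleton w₀ gs g
    have hbound : eNew ≤ eOld + D := by
      rw [heNew, heOld, hw, Gate.args_subst_eq, List.map_map, Nat.add_assoc]
      refine Nat.add_le_add_left ?_ _
      refine foldr_max_map_le_foldr_max_map_add _ fun u _ => ?_
      simp only [Function.comp_apply]
      rw [hn]
      exact Operand.depthIn_subst_le hρ u hle
    refine ⟨E ++ [eNew], hnew, by simp [hlen], fun j => ?_⟩
    rw [hold]
    rcases lt_trichotomy j gs.length with hj | hj | hj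
    · rw [List.getD_append _ _ _ _ (by rw [hlen]; exact hj),
        List.getD_append _ _ _ _ (by rw [gateWDepths_length]; exact hj)]
      exact hle j
    · subst hj
      rw [List.getD_append_right _ _ _ _ (by rw [hlen]),
        List.getD_append_right _ _ _ _ (by rw [gateWDepths_length]), hlen, gateWDepths_length,
        Nat.sub_self, List.getD_cons_zero, List.getD_cons_zero]
      exact hbound
    · rw [List.getD_eq_default _ _ (by simp [hlen]; omega)]
      exact Nat.zero_le _

/-- **Depth of the substitution circuit, with slack**: `wdepth w (substCircuit P pre ρ) ≤
wdepth w₀ P + D`, `D` a bound on the depths of the substituted operands against the prefix.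
[cite: Burgisser2000, Rem. 2.7] -/
theorem wdepth_substCircuit_le (w : Gate k τ → ℕ) (w₀ : Gate k σ → ℕ) {ρ : σ → Operand k τ}
    {pre : List (Gate k τ)} (hw : ∀ g, w (g.subst ρ pre.length) = w₀ g) {D : ℕ}
    (hρ : ∀ i ds, (ρ i).depthIn (gateWDepths w pre ++ ds) ≤ D) (P : ArithCircuit k σ) :
    (P.substCircuit pre ρ).wdepth w ≤ P.wdepth w₀ + D := by
  obtain ⟨E, hE, -, hle⟩ := gateWDepths_substCircuit_le w w₀ hw hρ P.gates
  have hn : pre.length = (gateWDepths w pre).length := (gateWDepths_length w pre).symm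
  unfold wdepth
  change (P.output.subst ρ pre.length).depthIn
      (gateWDepths w (pre ++ P.gates.map (Gate.subst ρ pre.length))) ≤ _
  rw [hE, hn]
  exact Operand.depthIn_subst_le hρ P.output hle

/-- **Product-depth of the substitution circuit**: at most `productDepth P + D`, `D` a bound on the
product-depths of the substituted operands against the prefix. [cite: LimayeSrinivasanTavenas2021, §2] -/
theorem productDepth_substCircuit_le {ρ : σ → Operand k τ} {pre : List (Gate k τ)} {D : ℕ}
    (hρ : ∀ i ds, (ρ i).depthIn (gateWDepths prodWeight pre ++ ds) ≤ D) (P : ArithCircuit k σ) :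
    (P.substCircuit pre ρ).productDepth ≤ P.productDepth + D := by
  rw [productDepth_eq_wdepth_prodWeight, productDepth_eq_wdepth_prodWeight]
  exact wdepth_substCircuit_le prodWeight prodWeight (fun g => by cases g <;> rfl) hρ P

/-- **Depth of the substitution circuit**: at most `depth P + D`, `D` a bound on the depths of the
substituted operands against the prefix. [cite: Burgisser2000, Rem. 2.7] -/
theorem depth_substCircuit_le {ρ : σ → Operand k τ} {pre : List (Gate k τ)} {D : ℕ}
    (hρ : ∀ i ds, (ρ i).depthIn (gateWDepths (fun _ => 1) pre ++ ds) ≤ D) (P : ArithCircuit k σ) :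
    (P.substCircuit pre ρ).depth ≤ P.depth + D :=
  wdepth_substCircuit_le (fun _ => 1) (fun _ => 1) (fun _ => rfl) hρ P

end Subst

/-! ### The packaged composition `compose P Q`: circuits for ALL inputs of `P` -/

section Compose

variable [Fintype σ]

/-- The circuits `Q i` listed in the order of `Fintype.equivFin σ`. [cite: Burgisser2000, proof of Prop. 2.3] -/
def compList (Q : σ → ArithCircuit k τ) : List (ArithCircuit k τ) :=
  List.ofFn fun j : Fin (Fintype.card σ) => Q ((Fintype.equivFin σ).symm j)

omit [Fintype σ] in
/-- One listed circuit per input. [cite: Burgisser2000, proof of Prop. 2.3] -/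
@[simp] theorem length_compList [Fintype σ] (Q : σ → ArithCircuit k τ) :
    (compList Q).length = Fintype.card σ := by
  simp [compList]

/-- The listed circuit at the position of `i` is `Q i`. [cite: Burgisser2000, proof of Prop. 2.3] -/
theorem getElem_compList (Q : σ → ArithCircuit k τ) (i : σ)
    (h : ((Fintype.equivFin σ i : ℕ)) < (compList Q).length) :
    (compList Q)[(Fintype.equivFin σ i : ℕ)]'h = Q i := by
  simp [compList, List.getElem_ofFn]

/-- Sums over the listed circuits are sums over `σ`. [cite: Burgisser2000, proof of Prop. 2.3] -/
theorem sum_map_compList (Q : σ → ArithCircuit k τ) (f : ArithCircuit k τ → ℕ) :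
    ((compList Q).map f).sum = ∑ i, f (Q i) := by
  rw [compList, List.map_ofFn, List.sum_ofFn]
  exact Fintype.sum_equiv (Fintype.equivFin σ).symm _ _ fun j => rfl

variable [Zero k]

/-- The operand reading the output of `Q i` off the juxtaposition of all the `Q j`.
[cite: Burgisser2000, proof of Prop. 2.3] -/
def compOperand (Q : σ → ArithCircuit k τ) (i : σ) : Operand k τ :=
  (juxtOuts (compList Q))[(Fintype.equivFin σ i : ℕ)]'(by simp)

/-- **Composition** `P(Q)`: the juxtaposition of the circuits `Q i` (`i : σ`, a `Fintype`)
followed by the gates of `P` with every input `x_i` replaced by the output of `Q i`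
(Bürgisser 2000, proof of Prop. 2.3 / Rem. 2.7, via the tree's `substCircuit` / `juxtGates`).
[cite: Burgisser2000, Rem. 2.7] -/
def compose (P : ArithCircuit k σ) (Q : σ → ArithCircuit k τ) : ArithCircuit k τ :=
  P.substCircuit (juxtGates (compList Q)) (compOperand Q)

/-- **Gates of the composition**: `|P| + Σ_i |Q i|`. [cite: Burgisser2000, proof of Prop. 2.3] -/
theorem size_compose (P : ArithCircuit k σ) (Q : σ → ArithCircuit k τ) :
    (P.compose Q).size = P.size + ∑ i, (Q i).size := by
  rw [compose, size_substCircuit, length_juxtGates, sum_map_compList, add_comm]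

/-- **Wires of the composition**: `edgeSize (P.compose Q) = edgeSize P + Σ_i edgeSize (Q i)`.
[cite: LimayeSrinivasanTavenas2021, §2] -/
theorem edgeSize_compose (P : ArithCircuit k σ) (Q : σ → ArithCircuit k τ) :
    (P.compose Q).edgeSize = P.edgeSize + ∑ i, (Q i).edgeSize := by
  rw [compose, edgeSize_substCircuit, sum_fanIn_juxtGates, sum_map_compList, add_comm]

/-- **Depth of the composition, general weight**: for a gate weight `w` on `τ`-gates invariant
under shifting and agreeing with `w₀` on transported gates, `wdepth w (P.compose Q) ≤
wdepth w₀ P + D` whenever every `Q i` has `w`-depth `≤ D`. [cite: Burgisser2000, proof of Prop. 2.3] -/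
theorem wdepth_compose_le (w : Gate k τ → ℕ) (w₀ : Gate k σ → ℕ)
    (hws : ∀ n g, w (Gate.shift n g) = w g) (hw : ∀ (ρ : σ → Operand k τ) n g, w (g.subst ρ n) = w₀ g)
    {Q : σ → ArithCircuit k τ} {D : ℕ} (hQ : ∀ i, (Q i).wdepth w ≤ D) (P : ArithCircuit k σ) :
    (P.compose Q).wdepth w ≤ P.wdepth w₀ + D := by
  refine wdepth_substCircuit_le w w₀ (hw _ _) (fun i ds => ?_) P
  unfold compOperand
  rw [depthIn_juxtOuts w hws (compList Q) _ (by simp) ds, getElem_compList]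
  exact hQ i

/-- **Product-depth of the composition**: `≤ productDepth P + D` whenever every `Q i` has
product-depth `≤ D` (product-depths along a path add up). [cite: LimayeSrinivasanTavenas2021, §2] -/
theorem productDepth_compose_le {Q : σ → ArithCircuit k τ} {D : ℕ}
    (hQ : ∀ i, (Q i).productDepth ≤ D) (P : ArithCircuit k σ) :
    (P.compose Q).productDepth ≤ P.productDepth + D := by
  rw [productDepth_eq_wdepth_prodWeight, productDepth_eq_wdepth_prodWeight]
  exact wdepth_compose_le prodWeight prodWeight (fun n g => by cases g <;> rfl)
    (fun ρ n g => by cases g <;> rfl) (fun i => by rw [← productDepth_eq_wdepth_prodWeight]; exact hQ i) P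

/-- **Depth of the composition**: `≤ depth P + D` whenever every `Q i` has depth `≤ D`.
[cite: Burgisser2000, proof of Prop. 2.3] -/
theorem depth_compose_le {Q : σ → ArithCircuit k τ} {D : ℕ} (hQ : ∀ i, (Q i).depth ≤ D)
    (P : ArithCircuit k σ) : (P.compose Q).depth ≤ P.depth + D :=
  wdepth_compose_le (fun _ => 1) (fun _ => 1) (fun _ _ => rfl) (fun _ _ _ => rfl) hQ P

/-- The composition of fan-in-two circuits has fan-in two. [cite: Burgisser2000, proof of Prop. 2.3] -/
theorem IsFanInTwo.compose {P : ArithCircuit k σ} (hP : P.IsFanInTwo) {Q : σ → ArithCircuit k τ}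
    (hQ : ∀ i, (Q i).IsFanInTwo) : (P.compose Q).IsFanInTwo := by
  refine hP.substCircuit (fanIn_juxtGates fun R hR => ?_) _
  rw [compList, List.mem_ofFn] at hR
  obtain ⟨j, rfl⟩ := hR
  exact hQ _

end Compose

section ComposeEval

variable [Fintype σ] [CommSemiring k]

/-- **Semantics of the composition**: `P.compose Q` computes `P.eval (Q₁.eval, …)`, i.e.
`aeval (fun i => (Q i).eval) P.eval`. [cite: Burgisser2000, Rem. 2.7] -/
theorem eval_compose (P : ArithCircuit k σ) (Q : σ → ArithCircuit k τ) :
    (P.compose Q).eval = aeval (fun i => (Q i).eval) P.eval := by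
  refine eval_substCircuit P _ (fun i ws => ?_)
  unfold compOperand
  rw [eval_juxtOuts (compList Q) _ (by simp) ws, getElem_compList]

/-- The composition computes the substitution `f(g₁, …)` (`aeval g f`) when `P` computes `f` and
`Q i` computes `g i`. [cite: Burgisser2000, Rem. 2.7] -/
theorem Computes.compose {P : ArithCircuit k σ} {f : MvPolynomial σ k} (hP : P.Computes f)
    {Q : σ → ArithCircuit k τ} {g : σ → MvPolynomial τ k} (hQ : ∀ i, (Q i).Computes (g i)) :
    (P.compose Q).Computes (aeval g f) := by
  rw [Computes] at hP ⊢
  have hg : (fun i => (Q i).eval) = g := funext hQ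
  rw [eval_compose, hP, hg]

/-- `bind₁` form of `Computes.compose` (`bind₁ g = aeval g`). [cite: Burgisser2000, Rem. 2.7] -/
theorem Computes.compose_bind₁ {P : ArithCircuit k σ} {f : MvPolynomial σ k} (hP : P.Computes f)
    {Q : σ → ArithCircuit k τ} {g : σ → MvPolynomial τ k} (hQ : ∀ i, (Q i).Computes (g i)) :
    (P.compose Q).Computes (bind₁ g f) :=
  hP.compose hQ

end ComposeEval

end ArithCircuit

end Literature.Computability.AlgebraicComplexity
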